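import Summits.CriticalPhenomena.SAWScalingLimit.Theses.SAWRenewalTightness
import Summits.CriticalPhenomena.SAWScalingLimit.Theses.SAWRestrictionRigidity
import Summits.CriticalPhenomena.SAWScalingLimit.Theses.SAWWeldingIdentification
import Summits.CriticalPhenomena.SAWScalingLimit.Theorems.SAWRenewalTightnessEventualTightOfBoundedVirginArc
import Summits.CriticalPhenomena.SAWScalingLimit.Theorems.SAWRenewalTightnessEventualTightOfBoundaryBulk
import Summits.CriticalPhenomena.SAWScalingLimit.Theorems.SAWRenewalTightnessEventualTightOfBoundaryRepulsion

/-!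
# Line `Sketch` — skeleton for the crux `SAWRenewalTightness.EventualTight` (stmt-CriticalPhenomena-1372), registration v14

**Registration v14 (2026-08-17, lead c14, continuation seat prover-line-stmt-CriticalPhenomena-1372-c14-0) — E-free RESHAPE.**
v1–v13 (leads c1–c13; last tree copy sha256 eda6d431…, evidence `Sketch-v12.lean` / `Sketch-v13.lean` on the item, 1491 lines) grew
the line to a composition-complete skeleton whose every provable rung is LANDED (p141593 … p164717; vocabulary in
`Theorems/SAWRenewalTightnessEventualTightSketchDefs.lean`, the V-chain in `Theorems/SAWRenewalTightnessEventualTightOfBoundedVirginArc.lean`)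
and whose two open `sorry`s were, verbatim, the bet route's rev-9 children: the bulk atom X2c₁ᵇ `stub_virginArcTraversalTightBounded`
(= stmt-18042) and the restriction-positivity leaf E `stub_confinementPositivity` (= stmt-17587).  Since v13 two things happened:
E's own 3-cycle lead chain ended `line-dead` (15:08Z; five primitives open, none false), and the crux-strategist s4 registered the
two natural E-free cuts of the boundary half with their glue ACCEPTED (p172517 `…OfBoundaryBulk.lean`: `EventualTight ↔ BulkShellTight ∧
BoundaryShellTight`, B filed as route item stmt-19311; p173003 `…OfBoundaryRepulsion.lean`: `EventualTight ⟸ BR ∧ BulkShellTight`).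
v14 keeps the line's bulk half unchanged (X2c₁ᵇ through the landed `Theorems.bulkShellTight_of_virginArcTraversalTightBounded`) and
REPLACES E by B:

* `stub_virginArcTraversalTightBounded` — item stmt-CriticalPhenomena-18042 VERBATIM (unchanged since v9; held by the lead);
* `stub_boundaryShellTight` — item stmt-CriticalPhenomena-19311 VERBATIM = `Theses.SAWRenewalTightness.BoundaryShellTight` =
  `Theorems.TPToTraversalBound.Radial.BoundaryShellTight` (by `Iff.rfl`): per-domain, per-shell count tightness on frontier-centred shells.
  Crux-implied (`Theorems.boundaryShellTight_of_eventualTight`) and summit-implied (`Theorems.boundaryShellTight_of_sawScalingLimit`),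
  so — unlike E — it adds no refutation risk beyond LSW itself; with `BulkShellTight` (stmt-17588 ⟸ X2c₁ᵇ) it is EXACTLY the crux.

Composition (no `sorry` of its own): `EventualTight_of hXb hB := Theorems.eventualTight_of_virginArcTraversalTightBounded_of_boundaryShellTight hXb hB`.
Nothing earlier registrations proved is dropped: the E-composition of v9–v13 and the strategist's BR-composition are kept below as
sorry-free ALTERNATIVES taking E resp. BR as a hypothesis (`EventualTight_of_E`, `EventualTight_of_BR`), and the exact residual is
recorded (`eventualTight_iff_residual`).  `lean check`: sorries = 2 (the two `stub_*`); audit: `EventualTight_proof` /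
`_renewal` / `_welding` conclude the three route copies of the crux decl BY NAME (bodies syntactically identical).
Disproof honoured (`Cruxes/EventualTight/Disproof.lean` sha256 8b16ef40…, 12:40Z): §2 endpoint limits (spent inside V4 and
`TightOfShellCrossing_proof`), §3 the three quantifier strengthenings (both stubs keep `∃ k, δ₀` AFTER the shell/ε binders, `δ₀` per
`(D, a, b)`), §5 `eventualTight_false_without_jordan` (the Jordan loop is load-bearing in `stub_boundaryShellTight` and only there).
Lead's pass this cycle: `Cruxes/EventualTight/LeadAnalysis-c14.md`.
-/

namespace Summit.CriticalPhenomena.SAWScalingLimit.Cruxes.EventualTight.SketchV14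

open MeasureTheory Set Metric
open scoped ENNReal unitInterval
open Literature.Probability.RandomPlanarGeometry Literature.Probability.LatticeModels
open Summit.CriticalPhenomena.SAWScalingLimit.Theses.SAWRenewalTightness

/-! ### The two registered stubs (the ONLY `sorry`s of the file) -/

/-- **X2c₁ᵇ `stub_virginArcTraversalTightBounded`** — item stmt-CriticalPhenomena-18042, VERBATIM (same name and signature as in
v9–v13 and in `Lines/boundary_bulk.lean`; one proof of the item discharges all).  The bulk atom: for every relative extent `C` and
`θ > 0` there are a traversal number `k` and `N₀ > 0` such that for every FINITE exterior configuration — `H ≤ ℤ²` agreeing with `ℤ²` on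
the closed `(N+1)`-disc, `Λ ⊆ B̄(z₀, C·N)` containing every lattice point of the closed `N`-disc — and every two rim doors `(u, c)`,
`(u', c')`, the `x_c`-mass of self-avoiding `H`-arcs `c → c'` in `Λ` making `k` weak vertex traversals of `D(z₀; 2N/5, 3N/5)` is at most
`θ ×` the total arc mass.  Mesh-free, rate-free, uniform over exteriors; research-open (grounded open-problem, g83-1). [conjecture-grade] -/
theorem stub_virginArcTraversalTightBounded :
    ∀ C θ : ℝ, 0 < θ →
      ∃ (k : ℕ) (N₀ : ℝ), 0 < N₀ ∧
        ∀ (H : SimpleGraph (Site 2)) (Λ : Set (Site 2)) (z₀ : ℂ) (N : ℝ) (u c u' c' : Site 2),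
          Λ.Finite → (∀ v ∈ Λ, dist (Site.toComplex v) z₀ ≤ C * N) → N₀ ≤ N →
          (H ≤ zdGraph 2 ∧ (∀ v : Site 2, dist (Site.toComplex v) z₀ ≤ N → v ∈ Λ) ∧
            ∀ v v' : Site 2, dist (Site.toComplex v) z₀ ≤ N + 1 →
              dist (Site.toComplex v') z₀ ≤ N + 1 → (zdGraph 2).Adj v v' → H.Adj v v') →
          (H.Adj u c ∧ u ∉ Λ ∧ c ∈ Λ ∧ dist (Site.toComplex c) z₀ ≤ N ∧
            N < dist (Site.toComplex u) z₀) →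
          (H.Adj u' c' ∧ u' ∉ Λ ∧ c' ∈ Λ ∧ dist (Site.toComplex c') z₀ ≤ N ∧
            N < dist (Site.toComplex u') z₀) →
          ∑' p : {p : {p : H.Walk c c' // p.IsPath ∧ ∀ v ∈ p.support, v ∈ Λ} //
              ∃ ι κ : Fin k → Fin (p.1.support.map Site.toComplex).length, (∀ m, ι m ≤ κ m) ∧
                (∀ m, (dist ((p.1.support.map Site.toComplex).get (ι m)) z₀ ≤ 2 * N / 5 ∧
                    3 * N / 5 ≤ dist ((p.1.support.map Site.toComplex).get (κ m)) z₀) ∨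
                  (3 * N / 5 ≤ dist ((p.1.support.map Site.toComplex).get (ι m)) z₀ ∧
                    dist ((p.1.support.map Site.toComplex).get (κ m)) z₀ ≤ 2 * N / 5)) ∧
                ∀ ⦃m m'⦄, m < m' → κ m ≤ ι m'},
              ENNReal.ofReal (SAW.criticalFugacity ^ p.1.1.length) ≤
            ENNReal.ofReal θ *
              ∑' p : {p : H.Walk c c' // p.IsPath ∧ ∀ v ∈ p.support, v ∈ Λ},
                ENNReal.ofReal (SAW.criticalFugacity ^ p.1.length) := by
  sorry

/-- **B `stub_boundaryShellTight`** — item stmt-CriticalPhenomena-19311, VERBATIM (= `Theses.SAWRenewalTightness.BoundaryShellTight`,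
= `Theorems.TPToTraversalBound.Radial.BoundaryShellTight`, both by `Iff.rfl`; same name and signature as in `Lines/boundary_bulk.lean`):
for every Dobrushin domain `(D; a, b)` with an endpoint approximation, every frontier-centred shell `D(x; ρ, R)` (`x ∈ ∂D`, `0 < ρ`,
`4ρ ≤ R ≤ 1`) and every `ε > 0` there are `k` and `δ₀ > 0` (depending on the shell) with `P_δ[≥ k separate traversals] ≤ ε` for
`δ ∈ (0, δ₀]`.  No rate, no uniformity in the shell; the Jordan loop of `D` is load-bearing here.  Crux-implied and summit-implied
(kernel-checked), research-open (KS Condition-G2 content at boundary annuli for the `x_c`-SAW, count form). [conjecture-grade] -/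
theorem stub_boundaryShellTight :
    ∀ (D : DobrushinDomain) (a b : ℝ → Site 2), SAW.IsEndpointApprox D a b →
      ∀ (x : ℂ) (ρ R : ℝ), x ∈ frontier D.carrier → 0 < ρ → 4 * ρ ≤ R → R ≤ 1 → ∀ ε : ℝ, 0 < ε →
        ∃ (k : ℕ) (δ₀ : ℝ), 0 < δ₀ ∧ ∀ δ ∈ Set.Ioc (0 : ℝ) δ₀,
          SAW.law D.carrier δ (a δ) (b δ)
            {γ | (⟨γ.walk.toCurve (meshPoint δ)⟩ : Curve ℂ).HasTraversals k x ρ R} ≤ ENNReal.ofReal ε := by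
  sorry

/-! ### The stubs ARE the items (definitionally) -/

/-- X2c₁ᵇ is, by `Iff.rfl`, the bet route's item decl `SAWWeldingIdentification.VirginArcTraversalTightBounded` (stmt-18042). [folklore] -/
theorem stub_virginArcTraversalTightBounded_iff_item :
    (∀ C θ : ℝ, 0 < θ →
      ∃ (k : ℕ) (N₀ : ℝ), 0 < N₀ ∧
        ∀ (H : SimpleGraph (Site 2)) (Λ : Set (Site 2)) (z₀ : ℂ) (N : ℝ) (u c u' c' : Site 2),
          Λ.Finite → (∀ v ∈ Λ, dist (Site.toComplex v) z₀ ≤ C * N) → N₀ ≤ N →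
          (H ≤ zdGraph 2 ∧ (∀ v : Site 2, dist (Site.toComplex v) z₀ ≤ N → v ∈ Λ) ∧
            ∀ v v' : Site 2, dist (Site.toComplex v) z₀ ≤ N + 1 →
              dist (Site.toComplex v') z₀ ≤ N + 1 → (zdGraph 2).Adj v v' → H.Adj v v') →
          (H.Adj u c ∧ u ∉ Λ ∧ c ∈ Λ ∧ dist (Site.toComplex c) z₀ ≤ N ∧
            N < dist (Site.toComplex u) z₀) →
          (H.Adj u' c' ∧ u' ∉ Λ ∧ c' ∈ Λ ∧ dist (Site.toComplex c') z₀ ≤ N ∧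
            N < dist (Site.toComplex u') z₀) →
          ∑' p : {p : {p : H.Walk c c' // p.IsPath ∧ ∀ v ∈ p.support, v ∈ Λ} //
              ∃ ι κ : Fin k → Fin (p.1.support.map Site.toComplex).length, (∀ m, ι m ≤ κ m) ∧
                (∀ m, (dist ((p.1.support.map Site.toComplex).get (ι m)) z₀ ≤ 2 * N / 5 ∧
                    3 * N / 5 ≤ dist ((p.1.support.map Site.toComplex).get (κ m)) z₀) ∨
                  (3 * N / 5 ≤ dist ((p.1.support.map Site.toComplex).get (ι m)) z₀ ∧
                    dist ((p.1.support.map Site.toComplex).get (κ m)) z₀ ≤ 2 * N / 5)) ∧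
                ∀ ⦃m m'⦄, m < m' → κ m ≤ ι m'},
              ENNReal.ofReal (SAW.criticalFugacity ^ p.1.1.length) ≤
            ENNReal.ofReal θ *
              ∑' p : {p : H.Walk c c' // p.IsPath ∧ ∀ v ∈ p.support, v ∈ Λ},
                ENNReal.ofReal (SAW.criticalFugacity ^ p.1.length)) ↔
    Summit.CriticalPhenomena.SAWScalingLimit.Theses.SAWWeldingIdentification.VirginArcTraversalTightBounded :=
  Iff.rfl

/-- B is, by `Iff.rfl`, the route item decl `SAWRenewalTightness.BoundaryShellTight` (stmt-19311) and the TotalPositivity route's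
isolated open content `Theorems.TPToTraversalBound.Radial.BoundaryShellTight`. [folklore] -/
theorem stub_boundaryShellTight_iff_item :
    (∀ (D : DobrushinDomain) (a b : ℝ → Site 2), SAW.IsEndpointApprox D a b →
      ∀ (x : ℂ) (ρ R : ℝ), x ∈ frontier D.carrier → 0 < ρ → 4 * ρ ≤ R → R ≤ 1 → ∀ ε : ℝ, 0 < ε →
        ∃ (k : ℕ) (δ₀ : ℝ), 0 < δ₀ ∧ ∀ δ ∈ Set.Ioc (0 : ℝ) δ₀,
          SAW.law D.carrier δ (a δ) (b δ)
            {γ | (⟨γ.walk.toCurve (meshPoint δ)⟩ : Curve ℂ).HasTraversals k x ρ R} ≤ ENNReal.ofReal ε) ↔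
    (BoundaryShellTight ∧ Summit.CriticalPhenomena.SAWScalingLimit.Theorems.TPToTraversalBound.Radial.BoundaryShellTight) :=
  ⟨fun h => ⟨h, h⟩, fun h => h.1⟩

/-! ### Registered names of the stub statements -/

namespace Registered

/-- Registered stub X2c₁ᵇ (item stmt-18042). -/
abbrev stub_virginArcTraversalTightBounded : Prop :=
  Summit.CriticalPhenomena.SAWScalingLimit.Theses.SAWWeldingIdentification.VirginArcTraversalTightBounded

/-- Registered stub B (item stmt-19311). -/
abbrev stub_boundaryShellTight : Prop := BoundaryShellTight

end Registered

/-! ### The skeleton theorem: the stubs imply the crux, BY NAME -/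

/-- **`EventualTight` from the line `Sketch` (v14)** (kernel-checked, no `sorry` of its own): the bulk atom X2c₁ᵇ gives the bulk child
`BulkShellTight` through the landed virginization chain (`Theorems.bulkShellTight_of_virginArcTraversalTightBounded`: V4 + rung B + aspect
reduction), and bulk ∧ boundary per-shell count tightness is exactly the crux (`Theorems.eventualTight_of_bulkShellTight_of_boundaryShellTight`,
p172517: fat-shell dichotomy + `shellCrossing_of_fatShellDecay` + `TightOfShellCrossing_proof`). -/
theorem EventualTight_of (hXb : Registered.stub_virginArcTraversalTightBounded) (hB : Registered.stub_boundaryShellTight) :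
    EventualTight :=
  Theorems.eventualTight_of_virginArcTraversalTightBounded_of_boundaryShellTight hXb hB

/-- **The crux proof modulo the stubs**, concluding the `SAWRestrictionRigidity` copy of the crux decl (the item's recorded `crux_decl`;
the three route copies have syntactically identical bodies). -/
theorem EventualTight_proof :
    Summit.CriticalPhenomena.SAWScalingLimit.Theses.SAWRestrictionRigidity.EventualTight :=
  EventualTight_of stub_virginArcTraversalTightBounded stub_boundaryShellTight

/-- The same wiring check against the `SAWRenewalTightness` copy of the crux decl (payload.route_id). -/
theorem EventualTight_proof_renewal :
    Summit.CriticalPhenomena.SAWScalingLimit.Theses.SAWRenewalTightness.EventualTight :=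
  EventualTight_of stub_virginArcTraversalTightBounded stub_boundaryShellTight

/-- The same wiring check against the bet route's copy `SAWWeldingIdentification.EventualTight`. -/
theorem EventualTight_proof_welding :
    Summit.CriticalPhenomena.SAWScalingLimit.Theses.SAWWeldingIdentification.EventualTight :=
  EventualTight_of stub_virginArcTraversalTightBounded stub_boundaryShellTight

/-! ### Kept from earlier registrations, sorry-free: the alternative boundary halves and the exact residual -/

/-- **v9–v13 composition (E-route), kept as an alternative**: X2c₁ᵇ and the restriction-positivity leaf E = `ConfinementPositivity`
(stmt-17587, taken here as a HYPOTHESIS, no longer a registered stub) give the crux (`Theorems.eventualTight_of_virginArcTraversalTightBounded_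
of_confinementPositivity`, p151500).  E's own lead chain ended line-dead 2026-08-17T15:08Z with its primitives open, not refuted. -/
theorem EventualTight_of_E (hXb : Registered.stub_virginArcTraversalTightBounded) (hE : ConfinementPositivity) : EventualTight :=
  Theorems.eventualTight_of_virginArcTraversalTightBounded_of_confinementPositivity hXb hE

/-- **Strategist s4's one-scale boundary atom BR (line `boundary_repulsion`), kept as an alternative**: collar avoidance off the sockets
plus X2c₁ᵇ gives the crux (`Theorems.eventualTight_of_boundaryRepulsion_of_virginArcTraversalTightBounded`, p173003).  BR is
summit-plausible but NOT crux-implied, hence not registered as a stub of this line. -/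
theorem EventualTight_of_BR (hXb : Registered.stub_virginArcTraversalTightBounded)
    (hBR : ∀ (D : DobrushinDomain) (a b : ℝ → Site 2), SAW.IsEndpointApprox D a b →
      ∀ d : ℝ, 0 < d → ∀ ε : ℝ, 0 < ε → ∃ (s δ₁ : ℝ), 0 < s ∧ 0 < δ₁ ∧ ∀ δ ∈ Set.Ioc (0 : ℝ) δ₁,
        SAW.law D.carrier δ (a δ) (b δ)
          {γ | ∃ t : I, d ≤ dist ((⟨γ.walk.toCurve (meshPoint δ)⟩ : Curve ℂ) t) (D.pt 0) ∧
                d ≤ dist ((⟨γ.walk.toCurve (meshPoint δ)⟩ : Curve ℂ) t) (D.pt 1) ∧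
                Metric.infDist ((⟨γ.walk.toCurve (meshPoint δ)⟩ : Curve ℂ) t) D.carrierᶜ ≤ s} ≤
          ENNReal.ofReal ε) :
    EventualTight :=
  Theorems.eventualTight_of_boundaryRepulsion_of_virginArcTraversalTightBounded hBR hXb

/-- **B follows from BR and the bulk atom** (p173003 + the V-chain): the registered boundary stub is weaker than the strategist's BR
given X2c₁ᵇ. [folklore] -/
theorem stub_boundaryShellTight_of_BR (hXb : Registered.stub_virginArcTraversalTightBounded)
    (hBR : ∀ (D : DobrushinDomain) (a b : ℝ → Site 2), SAW.IsEndpointApprox D a b →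
      ∀ d : ℝ, 0 < d → ∀ ε : ℝ, 0 < ε → ∃ (s δ₁ : ℝ), 0 < s ∧ 0 < δ₁ ∧ ∀ δ ∈ Set.Ioc (0 : ℝ) δ₁,
        SAW.law D.carrier δ (a δ) (b δ)
          {γ | ∃ t : I, d ≤ dist ((⟨γ.walk.toCurve (meshPoint δ)⟩ : Curve ℂ) t) (D.pt 0) ∧
                d ≤ dist ((⟨γ.walk.toCurve (meshPoint δ)⟩ : Curve ℂ) t) (D.pt 1) ∧
                Metric.infDist ((⟨γ.walk.toCurve (meshPoint δ)⟩ : Curve ℂ) t) D.carrierᶜ ≤ s} ≤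
          ENNReal.ofReal ε) :
    Registered.stub_boundaryShellTight :=
  Theorems.boundaryShellTight_of_boundaryRepulsion_of_bulkShellTight hBR
    (Theorems.bulkShellTight_of_virginArcTraversalTightBounded hXb)

/-- **Exact residual of the crux on this line** (p172517): `EventualTight ↔ BulkShellTight ∧ BoundaryShellTight` — stmt-17588 (⟸ X2c₁ᵇ,
landed) and stmt-19311, each crux-implied, jointly equivalent. [folklore] -/
theorem eventualTight_iff_residual : EventualTight ↔ (BulkShellTight ∧ BoundaryShellTight) :=
  Theorems.eventualTight_iff_bulkShellTight_and_boundaryShellTight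

/-- **The registered boundary stub is crux-implied** (no refutation risk beyond the crux). [folklore] -/
theorem stub_boundaryShellTight_of_eventualTight (hT : EventualTight) : Registered.stub_boundaryShellTight :=
  Theorems.boundaryShellTight_of_eventualTight hT

/-- **… and summit-implied** (false only if `SAWScalingLimit` is). [folklore] -/
theorem stub_boundaryShellTight_of_sawScalingLimit (h : SAW.SAWScalingLimit) : Registered.stub_boundaryShellTight :=
  Theorems.boundaryShellTight_of_sawScalingLimit h

/-- **The bulk atom closes the bulk child** stmt-17588 (landed V-chain), recorded for the census. [folklore] -/
theorem bulkShellTight_of_stub (hXb : Registered.stub_virginArcTraversalTightBounded) : BulkShellTight :=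
  Theorems.bulkShellTight_of_virginArcTraversalTightBounded hXb

end Summit.CriticalPhenomena.SAWScalingLimit.Cruxes.EventualTight.SketchV14
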